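import Mathlib
import HarnessLib

/-!
# Negative knowledge for the crux `InertialRecession` (item stmt-FinalStateConjecture-10166), IV:
SHARPNESS of the clean-scale Cesàro mechanism at exponent `p = 1`

Refuter file (D-0016 negative lane, `--supports stmt-FinalStateConjecture-10166`); companion of
`CleanScaleCesaro.lean` (`tendsto_div_of_abs_deriv2_le_rpow`: `|s''| ≤ K |s|^{-p}`, `p > 1`, bounded
`s'` ⇒ `s(t)/t` converges). No Theses decl is asserted.

* `not_tendsto_div_at_exponent_one`: at `p = 1` every hypothesis of that theorem holds (`t₀ = 3`,
  `K = 9`, `v = 4`) for `s t = t (2 + sin (log (log t)))`, yet `s(t)/t = 2 + sin (log (log t))` does not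
  converge — a force `K/d` at separation `d` can make the Cesàro mean wander forever, `log log`-slowly.
  In crux units (`p = 2w - 2` for a cone weight `d^w` on `|∂h|`, clean-sphere flux `ε² d^{2-2w}`): the
  typed weight `w = 7/4` gives `p = 3/2 > 1`; at `w = 3/2` the mechanism is dead. The margin is
  load-bearing even for CESÀRO velocities, not only for the integrable-force route of the item's
  why-might-fail.
-/

set_option linter.dupNamespace false

noncomputable section

namespace Summit.FinalStateConjecture.FinalStateConjecture.Theorems.InertialRecession.Negative

open Filter Set
open scoped Topology

/-! ## Sharpness: at `p = 1` the Cesàro mean may wander forever -/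

/-- The `p = 1` witness `s t = t (2 + sin (log (log t)))`. [folklore] -/
def slowWitness (t : ℝ) : ℝ := t * (2 + Real.sin (Real.log (Real.log t)))

/-- Its velocity `2 + sin u + cos u / log t`, `u = log (log t)`. [folklore] -/
def slowWitnessD1 (t : ℝ) : ℝ :=
  2 + Real.sin (Real.log (Real.log t)) + Real.cos (Real.log (Real.log t)) * (Real.log t)⁻¹

/-- Its acceleration `(cos u - sin u / log t - cos u / log t) / (t log t)`. [folklore] -/
def slowWitnessD2 (t : ℝ) : ℝ :=
  (Real.cos (Real.log (Real.log t)) - Real.sin (Real.log (Real.log t)) * (Real.log t)⁻¹ -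
    Real.cos (Real.log (Real.log t)) * (Real.log t)⁻¹) * (t * Real.log t)⁻¹

/-- `(log ∘ log)' = 1 / (t log t)` for `t > 1`. [folklore] -/
lemma hasDerivAt_loglog {t : ℝ} (ht : 1 < t) :
    HasDerivAt (fun t ↦ Real.log (Real.log t)) ((Real.log t)⁻¹ * t⁻¹) t := by
  have h1 : HasDerivAt Real.log t⁻¹ t := Real.hasDerivAt_log (by linarith)
  have hlog : Real.log t ≠ 0 := (Real.log_pos ht).ne'
  exact (Real.hasDerivAt_log hlog).comp t h1

/-- `slowWitness' = slowWitnessD1` on `(1, ∞)`. [folklore] -/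
lemma hasDerivAt_slowWitness {t : ℝ} (ht : 1 < t) : HasDerivAt slowWitness (slowWitnessD1 t) t := by
  have hu := hasDerivAt_loglog ht
  have h2 : HasDerivAt (fun t ↦ 2 + Real.sin (Real.log (Real.log t)))
      (Real.cos (Real.log (Real.log t)) * ((Real.log t)⁻¹ * t⁻¹)) t := by
    simpa using hu.sin.const_add 2
  have h3 := (hasDerivAt_id t).mul h2
  refine h3.congr_deriv ?_
  unfold slowWitnessD1
  simp only [id]
  have ht0 : t ≠ 0 := by linarith
  field_simp

/-- `slowWitnessD1' = slowWitnessD2` on `(1, ∞)`. [folklore] -/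
lemma hasDerivAt_slowWitnessD1 {t : ℝ} (ht : 1 < t) :
    HasDerivAt slowWitnessD1 (slowWitnessD2 t) t := by
  have hu := hasDerivAt_loglog ht
  have hlog : Real.log t ≠ 0 := (Real.log_pos ht).ne'
  have ht0 : t ≠ 0 := by linarith
  have hl : HasDerivAt Real.log t⁻¹ t := Real.hasDerivAt_log ht0
  have hlinv : HasDerivAt (fun t ↦ (Real.log t)⁻¹) (-(t⁻¹) / (Real.log t) ^ 2) t := hl.inv hlog
  have h : HasDerivAt slowWitnessD1 (Real.cos (Real.log (Real.log t)) * ((Real.log t)⁻¹ * t⁻¹) +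
      (-Real.sin (Real.log (Real.log t)) * ((Real.log t)⁻¹ * t⁻¹) * (Real.log t)⁻¹ +
        Real.cos (Real.log (Real.log t)) * (-(t⁻¹) / (Real.log t) ^ 2))) t := by
    unfold slowWitnessD1
    exact (hu.sin.const_add 2).add (hu.cos.mul hlinv)
  refine h.congr_deriv ?_
  unfold slowWitnessD2
  field_simp
  ring

/-- `log t ≥ 1` for `t ≥ 3` (`e < 3`). [folklore] -/
lemma one_le_log_of_three_le {t : ℝ} (ht : 3 ≤ t) : 1 ≤ Real.log t := by
  rw [Real.le_log_iff_exp_le (by linarith)]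
  have := Real.exp_one_lt_d9
  linarith

/-- Bounded velocity: `|slowWitnessD1| ≤ 4` on `[3, ∞)`. [folklore] -/
lemma abs_slowWitnessD1_le {t : ℝ} (ht : 3 ≤ t) : |slowWitnessD1 t| ≤ 4 := by
  have hl := one_le_log_of_three_le ht
  have hlinv : 0 ≤ (Real.log t)⁻¹ := inv_nonneg.mpr (by linarith)
  have hlinv1 : (Real.log t)⁻¹ ≤ 1 := inv_le_one_of_one_le₀ hl
  unfold slowWitnessD1
  have hs := Real.abs_sin_le_one (Real.log (Real.log t))
  have hc := Real.abs_cos_le_one (Real.log (Real.log t))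
  rw [abs_le] at hs hc ⊢
  have : |Real.cos (Real.log (Real.log t)) * (Real.log t)⁻¹| ≤ 1 := by
    rw [abs_mul, abs_of_nonneg hlinv]
    nlinarith [abs_nonneg (Real.cos (Real.log (Real.log t))), Real.abs_cos_le_one (Real.log (Real.log t))]
  rw [abs_le] at this
  constructor <;> linarith

/-- `slowWitness > 0` on `(0, ∞)`. [folklore] -/
lemma slowWitness_pos {t : ℝ} (ht : 0 < t) : 0 < slowWitness t := by
  unfold slowWitness
  have := Real.neg_one_le_sin (Real.log (Real.log t))
  exact mul_pos ht (by linarith)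

/-- `slowWitness t ≤ 3 t` on `(0, ∞)`. [folklore] -/
lemma slowWitness_le {t : ℝ} (ht : 0 < t) : slowWitness t ≤ 3 * t := by
  unfold slowWitness
  have := Real.sin_le_one (Real.log (Real.log t))
  nlinarith

/-- The force bound at exponent ONE: `|s''| ≤ 9 |s|^{-1}` for `t ≥ 3`. [folklore] -/
lemma abs_slowWitnessD2_le {t : ℝ} (ht : 3 ≤ t) :
    |slowWitnessD2 t| ≤ 9 * |slowWitness t| ^ (-1 : ℝ) := by
  have ht0 : 0 < t := by linarith
  have hl := one_le_log_of_three_le ht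
  have hl0 : 0 < Real.log t := by linarith
  have hlinv : 0 ≤ (Real.log t)⁻¹ := inv_nonneg.mpr hl0.le
  have hlinv1 : (Real.log t)⁻¹ ≤ 1 := inv_le_one_of_one_le₀ hl
  -- numerator bounded by 3
  have hnum : |Real.cos (Real.log (Real.log t)) - Real.sin (Real.log (Real.log t)) * (Real.log t)⁻¹ -
      Real.cos (Real.log (Real.log t)) * (Real.log t)⁻¹| ≤ 3 := by
    have hs := Real.abs_sin_le_one (Real.log (Real.log t))
    have hc := Real.abs_cos_le_one (Real.log (Real.log t))
    have h1 : |Real.sin (Real.log (Real.log t)) * (Real.log t)⁻¹| ≤ 1 := by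
      rw [abs_mul, abs_of_nonneg hlinv]; nlinarith [abs_nonneg (Real.sin (Real.log (Real.log t)))]
    have h2 : |Real.cos (Real.log (Real.log t)) * (Real.log t)⁻¹| ≤ 1 := by
      rw [abs_mul, abs_of_nonneg hlinv]; nlinarith [abs_nonneg (Real.cos (Real.log (Real.log t)))]
    calc _ ≤ |Real.cos (Real.log (Real.log t)) - Real.sin (Real.log (Real.log t)) * (Real.log t)⁻¹| +
          |Real.cos (Real.log (Real.log t)) * (Real.log t)⁻¹| := abs_sub _ _
      _ ≤ (|Real.cos (Real.log (Real.log t))| + |Real.sin (Real.log (Real.log t)) * (Real.log t)⁻¹|) +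
          |Real.cos (Real.log (Real.log t)) * (Real.log t)⁻¹| := by gcongr; exact abs_sub _ _
      _ ≤ (1 + 1) + 1 := by gcongr
      _ = 3 := by norm_num
  -- `|s''| ≤ 3 / (t log t) ≤ 3 / t`
  have hD2 : |slowWitnessD2 t| ≤ 3 * t⁻¹ := by
    unfold slowWitnessD2
    rw [abs_mul, abs_inv, abs_of_pos (by positivity : 0 < t * Real.log t), mul_inv]
    calc _ ≤ 3 * (t⁻¹ * (Real.log t)⁻¹) := by gcongr
      _ ≤ 3 * (t⁻¹ * 1) := by gcongr
      _ = 3 * t⁻¹ := by ring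
  -- `9 |s|^{-1} ≥ 9 / (3 t) = 3 / t`
  have hspos := slowWitness_pos ht0
  rw [abs_of_pos hspos, Real.rpow_neg_one]
  have h3 : 3 * t⁻¹ ≤ 9 * (slowWitness t)⁻¹ := by
    rw [show (9 : ℝ) * (slowWitness t)⁻¹ = 9 / slowWitness t by ring,
      show (3 : ℝ) * t⁻¹ = 3 / t by ring, div_le_div_iff₀ ht0 hspos]
    nlinarith [slowWitness_le ht0]
  exact hD2.trans h3

/-- `sin (log (log t)) = 1` arbitrarily late. [folklore] -/
lemma frequently_sin_loglog_eq_one : ∃ᶠ t in atTop, Real.sin (Real.log (Real.log t)) = 1 := by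
  rw [frequently_atTop]
  intro a
  obtain ⟨n, hn⟩ := exists_nat_ge a
  refine ⟨Real.exp (Real.exp (Real.pi / 2 + n * (2 * Real.pi))), ?_, ?_⟩
  · have h1 : (n : ℝ) ≤ Real.pi / 2 + n * (2 * Real.pi) := by
      nlinarith [Real.pi_gt_three, (Nat.cast_nonneg n : (0 : ℝ) ≤ n)]
    have h2 := Real.add_one_le_exp (Real.pi / 2 + n * (2 * Real.pi))
    have h3 := Real.add_one_le_exp (Real.exp (Real.pi / 2 + n * (2 * Real.pi)))
    linarith
  · rw [Real.log_exp, Real.log_exp, Real.sin_add_nat_mul_two_pi, Real.sin_pi_div_two]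

/-- `sin (log (log t)) = -1` arbitrarily late. [folklore] -/
lemma frequently_sin_loglog_eq_neg_one : ∃ᶠ t in atTop, Real.sin (Real.log (Real.log t)) = -1 := by
  rw [frequently_atTop]
  intro a
  obtain ⟨n, hn⟩ := exists_nat_ge a
  refine ⟨Real.exp (Real.exp (-(Real.pi / 2) + n * (2 * Real.pi))), ?_, ?_⟩
  · have h1 : (n : ℝ) ≤ -(Real.pi / 2) + n * (2 * Real.pi) + 1 + 1 := by
      nlinarith [Real.pi_gt_three, Real.pi_lt_four, (Nat.cast_nonneg n : (0 : ℝ) ≤ n)]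
    have h2 := Real.add_one_le_exp (-(Real.pi / 2) + n * (2 * Real.pi))
    have h3 := Real.add_one_le_exp (Real.exp (-(Real.pi / 2) + n * (2 * Real.pi)))
    linarith
  · rw [Real.log_exp, Real.log_exp, Real.sin_add_nat_mul_two_pi, Real.sin_neg, Real.sin_pi_div_two]

/-- `slowWitness t / t = 2 + sin (log (log t))` has no limit. [folklore] -/
theorem not_tendsto_slowWitness_div :
    ¬ ∃ L : ℝ, Tendsto (fun t ↦ slowWitness t / t) atTop (𝓝 L) := by
  rintro ⟨L, hL⟩
  have h : Tendsto (fun t ↦ 2 + Real.sin (Real.log (Real.log t))) atTop (𝓝 L) := by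
    refine hL.congr' ?_
    filter_upwards [eventually_gt_atTop 0] with t ht
    unfold slowWitness
    field_simp
  have e1 : L = 3 := tendsto_nhds_unique_of_frequently_eq h tendsto_const_nhds
    (frequently_sin_loglog_eq_one.mono fun t ht ↦ by rw [ht]; norm_num)
  have e2 : L = 1 := tendsto_nhds_unique_of_frequently_eq h tendsto_const_nhds
    (frequently_sin_loglog_eq_neg_one.mono fun t ht ↦ by rw [ht]; norm_num)
  linarith

/-- **Sharpness of the exponent.** At `p = 1` every hypothesis of `tendsto_div_of_abs_deriv2_le_rpow`
holds (`t₀ = 3`, `K = 9`, `v = 4`) for `s t = t (2 + sin (log (log t)))`, yet `s(t)/t` does not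
converge: a force `K/d` at separation `d` (cone weight `w = 3/2`) can make the Cesàro mean wander
forever, `log log`-slowly. [folklore] -/
theorem not_tendsto_div_at_exponent_one :
    ∃ (s s' s'' : ℝ → ℝ) (t₀ K v : ℝ), 0 < t₀ ∧ 0 ≤ K ∧
      (∀ t, t₀ ≤ t → HasDerivAt s (s' t) t) ∧ (∀ t, t₀ ≤ t → HasDerivAt s' (s'' t) t) ∧
      (∀ t, t₀ ≤ t → |s' t| ≤ v) ∧
      (∀ t, t₀ ≤ t → s t ≠ 0 → |s'' t| ≤ K * |s t| ^ (-(1 : ℝ))) ∧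
      ¬ ∃ L : ℝ, Tendsto (fun t ↦ s t / t) atTop (𝓝 L) :=
  ⟨slowWitness, slowWitnessD1, slowWitnessD2, 3, 9, 4, by norm_num, by norm_num,
    fun _ ht ↦ hasDerivAt_slowWitness (by linarith), fun _ ht ↦ hasDerivAt_slowWitnessD1 (by linarith),
    fun _ ht ↦ abs_slowWitnessD1_le ht, fun _ ht _ ↦ abs_slowWitnessD2_le ht,
    not_tendsto_slowWitness_div⟩

end Summit.FinalStateConjecture.FinalStateConjecture.Theorems.InertialRecession.Negative

end
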